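import Mathlib
import Summits.AtomisticToContinuum.Crystallization.Theorems.ChessboardParticlePlanesLjLaminarWindowsMassBoundA
import HarnessLib

/-! # All-spiky neighbourhoods are impossible in the sparse regime, part B — blob lemmas of stub
`stub_sparseAllSpiky` of line `Sketch` (skeleton rev. 14a, lead c8), crux `LjLaminarWindows`
(stmt-AtomisticToContinuum-6711)

Heavy blobs and the diffuse remainder: the number of `r₁`-separated heavy centres is bounded by the
mass bound (`sparse_heavy_card`), so is the total size of their `3r₁`-neighbourhoods
(`sparse_sum_blobs`), Bonferroni inside each blob bounds the total service of the heavy region to the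
ring shells (`sparse_heavy_service`), and every `r₁`-ball holds fewer than `c₂ L` diffuse particles
(`sparse_light`). -/

noncomputable section

open scoped BigOperators
open Filter Topology
open Literature.MathematicalPhysics.StatisticalMechanics
open Summit.AtomisticToContinuum.Crystallization.Theorems.ChargedEnergyGapNegative

namespace Summit.AtomisticToContinuum.Crystallization.Theorems.LjLaminarWindowsSketch

/-- Double counting: summing over `y ∈ Y` the number of `j` with `P y j` equals summing over `j` the
number of `y ∈ Y` with `P y j`. [folklore] -/
theorem sparse_sum_card_comm {α β : Type*} [Fintype β] (Y : Finset α) (P : α → β → Prop)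
    [∀ a b, Decidable (P a b)] :
    ∑ y ∈ Y, ((Finset.univ.filter fun j => P y j).card : ℝ) =
      ∑ j, ((Y.filter fun y => P y j).card : ℝ) := by
  have h : ∑ y ∈ Y, (Finset.univ.filter fun j => P y j).card =
      ∑ j, (Y.filter fun y => P y j).card := by
    simp only [Finset.card_filter]
    exact Finset.sum_comm
  exact_mod_cast h

/-- Multiplicity bound: if every `j` is related to at most `C` members of `Y`, and only members of `G`
are related to anybody, then `∑_{y ∈ Y} #{j : P y j} ≤ C · #G`. [folklore] -/
theorem sparse_sum_card_le_of_mult {α β : Type*} [Fintype β] (Y : Finset α) (G : Finset β)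
    (P : α → β → Prop) [∀ a b, Decidable (P a b)] {C : ℝ}
    (hmult : ∀ j, ((Y.filter fun y => P y j).card : ℝ) ≤ C)
    (hG : ∀ j, j ∉ G → ∀ y ∈ Y, ¬ P y j) :
    ∑ y ∈ Y, ((Finset.univ.filter fun j => P y j).card : ℝ) ≤ C * G.card := by
  classical
  rw [sparse_sum_card_comm]
  have hzero : ∀ j, j ∉ G → ((Y.filter fun y => P y j).card : ℝ) = 0 := by
    intro j hj
    rw [Nat.cast_eq_zero, Finset.card_eq_zero, Finset.filter_eq_empty_iff]
    exact fun y hy => hG j hj y hy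
  have hsplit : ∑ j, ((Y.filter fun y => P y j).card : ℝ) =
      ∑ j ∈ G, ((Y.filter fun y => P y j).card : ℝ) := by
    symm
    exact Finset.sum_subset (Finset.subset_univ G) fun j _ hj => hzero j hj
  rw [hsplit]
  calc ∑ j ∈ G, ((Y.filter fun y => P y j).card : ℝ) ≤ ∑ _j ∈ G, C :=
        Finset.sum_le_sum fun j _ => hmult j
    _ = C * G.card := by rw [Finset.sum_const, nsmul_eq_mul, mul_comm]

/-- Multiplicity of separated centres: a particle is within `k r₁` (`k ≥ 0`) of at most `(2k+1)³`
members of an `r₁`-separated family (`r₁ > 0`). [folklore] -/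
theorem sparse_mult_le {N : ℕ} (x : Fin N → E3) (hx : Function.Injective x) (Y : Finset (Fin N))
    {r₁ k : ℝ} (hr₁ : 0 < r₁) (hk : 0 ≤ k)
    (hYsep : ∀ y ∈ Y, ∀ y' ∈ Y, y ≠ y' → r₁ < dist (x y) (x y')) (j : Fin N) :
    ((Y.filter fun y => dist (x j) (x y) ≤ k * r₁).card : ℝ) ≤ (2 * k + 1) ^ 3 := by
  have h := massBound_sep_card x hx (Y.filter fun y => dist (x j) (x y) ≤ k * r₁) (x j) hr₁
    (by positivity : (0 : ℝ) ≤ k * r₁)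
    (fun y hy => by rw [dist_comm]; exact (Finset.mem_filter.1 hy).2)
    (fun y hy y' hy' hne => hYsep y (Finset.mem_filter.1 hy).1 y' (Finset.mem_filter.1 hy').1 hne)
  have e : 2 * (k * r₁) / r₁ + 1 = 2 * k + 1 := by field_simp
  rw [e] at h
  exact h

/-- Sum of neighbourhood sizes of separated centres near `a`: if the members of an `r₁`-separated
family `Y` lie within `6L/5` of `x a` and `6L/5 + k r₁ ≤ 2L`, then
`∑_{y ∈ Y} #{j : |x_j − x_y| ≤ k r₁} ≤ (2k+1)³ · #B_{2L}(a)`. [folklore] -/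
theorem sparse_sum_nbhd_le {N : ℕ} (x : Fin N → E3) (hx : Function.Injective x) (a : Fin N)
    (Y : Finset (Fin N)) {L r₁ k : ℝ} (hr₁ : 0 < r₁) (hk : 0 ≤ k) (hL : 6 / 5 * L + k * r₁ ≤ 2 * L)
    (hYa : ∀ y ∈ Y, dist (x y) (x a) ≤ 6 / 5 * L)
    (hYsep : ∀ y ∈ Y, ∀ y' ∈ Y, y ≠ y' → r₁ < dist (x y) (x y')) :
    ∑ y ∈ Y, ((Finset.univ.filter fun j => dist (x j) (x y) ≤ k * r₁).card : ℝ) ≤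
      (2 * k + 1) ^ 3 * ((Finset.univ.filter fun j => dist (x j) (x a) ≤ 2 * L).card : ℝ) := by
  refine sparse_sum_card_le_of_mult Y (Finset.univ.filter fun j => dist (x j) (x a) ≤ 2 * L)
    (fun y j => dist (x j) (x y) ≤ k * r₁) (fun j => sparse_mult_le x hx Y hr₁ hk hYsep j) ?_
  intro j hj y hy hjy
  refine hj (Finset.mem_filter.2 ⟨Finset.mem_univ _, ?_⟩)
  calc dist (x j) (x a) ≤ dist (x j) (x y) + dist (x y) (x a) := dist_triangle _ _ _
    _ ≤ k * r₁ + 6 / 5 * L := add_le_add hjy (hYa y hy)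
    _ ≤ 2 * L := by linarith

/-- **Few heavy centres.** If every member of an `r₁`-separated family `Y` within `6L/5` of `x a` is
heavy (`≥ c₂ L` particles within `2r₁`) and the `2L`-ball of `a` holds `≤ M` particles
(`6L/5 + 2r₁ ≤ 2L`), then `#Y · c₂ L ≤ 125 M`. [folklore] -/
theorem sparse_heavy_card {N : ℕ} (x : Fin N → E3) (hx : Function.Injective x) (a : Fin N)
    (Y : Finset (Fin N)) {L r₁ c₂ M : ℝ} (hr₁ : 0 < r₁) (hL : 6 / 5 * L + 2 * r₁ ≤ 2 * L)
    (hYa : ∀ y ∈ Y, dist (x y) (x a) ≤ 6 / 5 * L)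
    (hYsep : ∀ y ∈ Y, ∀ y' ∈ Y, y ≠ y' → r₁ < dist (x y) (x y'))
    (hYheavy : ∀ y ∈ Y, c₂ * L ≤ ((Finset.univ.filter fun j => dist (x j) (x y) ≤ 2 * r₁).card : ℝ))
    (hM : ((Finset.univ.filter fun j => dist (x j) (x a) ≤ 2 * L).card : ℝ) ≤ M) :
    (Y.card : ℝ) * (c₂ * L) ≤ 125 * M := by
  have h1 : (Y.card : ℝ) * (c₂ * L) ≤
      ∑ y ∈ Y, ((Finset.univ.filter fun j => dist (x j) (x y) ≤ 2 * r₁).card : ℝ) := by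
    have h := Finset.sum_le_sum hYheavy
    rw [Finset.sum_const, nsmul_eq_mul] at h
    exact h
  have h2 := sparse_sum_nbhd_le x hx a Y hr₁ (by norm_num : (0 : ℝ) ≤ 2) hL hYa hYsep
  have h125 : (2 * (2 : ℝ) + 1) ^ 3 = 125 := by norm_num
  rw [h125] at h2
  have h3 : (125 : ℝ) * ((Finset.univ.filter fun j => dist (x j) (x a) ≤ 2 * L).card : ℝ) ≤ 125 * M :=
    by linarith
  linarith

/-- **Total size of the blobs.** Under the same hypotheses with `6L/5 + 3r₁ ≤ 2L`:
`∑_{y ∈ Y} #{j : |x_j − x_y| ≤ 3r₁} ≤ 343 M`. [folklore] -/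
theorem sparse_sum_blobs {N : ℕ} (x : Fin N → E3) (hx : Function.Injective x) (a : Fin N)
    (Y : Finset (Fin N)) {L r₁ M : ℝ} (hr₁ : 0 < r₁) (hL : 6 / 5 * L + 3 * r₁ ≤ 2 * L)
    (hYa : ∀ y ∈ Y, dist (x y) (x a) ≤ 6 / 5 * L)
    (hYsep : ∀ y ∈ Y, ∀ y' ∈ Y, y ≠ y' → r₁ < dist (x y) (x y'))
    (hM : ((Finset.univ.filter fun j => dist (x j) (x a) ≤ 2 * L).card : ℝ) ≤ M) :
    ∑ y ∈ Y, ((Finset.univ.filter fun j => dist (x j) (x y) ≤ 3 * r₁).card : ℝ) ≤ 343 * M := by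
  have h2 := sparse_sum_nbhd_le x hx a Y hr₁ (by norm_num : (0 : ℝ) ≤ 3) hL hYa hYsep
  have h343 : (2 * (3 : ℝ) + 1) ^ 3 = 343 := by norm_num
  rw [h343] at h2
  have h3 : (343 : ℝ) * ((Finset.univ.filter fun j => dist (x j) (x a) ≤ 2 * L).card : ℝ) ≤ 343 * M :=
    by linarith
  linarith

/-- **Heavy service.** If the heavy region `Xh` is covered by the blobs `W y`, `y ∈ Y`, and inside
every blob the pairwise intersections of the ring shells `SH i`, `i < m`, hold at most `τ ≥ 0`
particles, then (Bonferroni inside each blob, `hBonf`)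
`∑_{i<m} #(SH i ∩ Xh) ≤ ∑_{y ∈ Y} #W y + #Y · m² τ`. [folklore] -/
theorem sparse_heavy_service {N : ℕ}
    (hBonf : ∀ (N' n : ℕ) (A : ℕ → Finset (Fin N')),
      ∑ i ∈ Finset.range n, ((A i).card : ℝ) ≤
        (((Finset.range n).biUnion A).card : ℝ) +
          ∑ i ∈ Finset.range n, ∑ j ∈ Finset.range i, ((A i ∩ A j).card : ℝ))
    (m : ℕ) (SH : ℕ → Finset (Fin N)) (Y : Finset (Fin N)) (W : Fin N → Finset (Fin N))
    (Xh : Finset (Fin N)) {τ : ℝ} (hτ : 0 ≤ τ) (hXh : Xh ⊆ Y.biUnion W)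
    (hI : ∀ y ∈ Y, ∀ i < m, ∀ j < i, ((SH i ∩ SH j ∩ W y).card : ℝ) ≤ τ) :
    ∑ i ∈ Finset.range m, ((SH i ∩ Xh).card : ℝ) ≤
      ∑ y ∈ Y, ((W y).card : ℝ) + (Y.card : ℝ) * ((m : ℝ) ^ 2 * τ) := by
  classical
  -- each term is bounded by the sum over the blobs
  have h1 : ∀ i, ((SH i ∩ Xh).card : ℝ) ≤ ∑ y ∈ Y, ((SH i ∩ W y).card : ℝ) := by
    intro i
    have hsub : SH i ∩ Xh ⊆ Y.biUnion fun y => SH i ∩ W y := by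
      intro j hj
      rw [Finset.mem_inter] at hj
      obtain ⟨y, hy, hjy⟩ := Finset.mem_biUnion.1 (hXh hj.2)
      exact Finset.mem_biUnion.2 ⟨y, hy, Finset.mem_inter.2 ⟨hj.1, hjy⟩⟩
    calc ((SH i ∩ Xh).card : ℝ) ≤ ((Y.biUnion fun y => SH i ∩ W y).card : ℝ) := by
          exact_mod_cast Finset.card_le_card hsub
      _ ≤ ∑ y ∈ Y, ((SH i ∩ W y).card : ℝ) := by exact_mod_cast Finset.card_biUnion_le
  -- Bonferroni inside each blob
  have h2 : ∀ y ∈ Y, ∑ i ∈ Finset.range m, ((SH i ∩ W y).card : ℝ) ≤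
      ((W y).card : ℝ) + (m : ℝ) ^ 2 * τ := by
    intro y hy
    have hB := hBonf N m (fun i => SH i ∩ W y)
    have hU : (((Finset.range m).biUnion fun i => SH i ∩ W y).card : ℝ) ≤ (W y).card := by
      exact_mod_cast Finset.card_le_card (Finset.biUnion_subset.2 fun i _ => Finset.inter_subset_right)
    have hP : ∑ i ∈ Finset.range m, ∑ j ∈ Finset.range i, (((SH i ∩ W y) ∩ (SH j ∩ W y)).card : ℝ) ≤
        (m : ℝ) ^ 2 * τ := by
      have h3 : ∀ i ∈ Finset.range m,
          ∑ j ∈ Finset.range i, (((SH i ∩ W y) ∩ (SH j ∩ W y)).card : ℝ) ≤ m * τ := by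
        intro i hi
        have hi' := Finset.mem_range.1 hi
        have h4 : ∀ j ∈ Finset.range i, (((SH i ∩ W y) ∩ (SH j ∩ W y)).card : ℝ) ≤ τ := by
          intro j hj
          have e : (SH i ∩ W y) ∩ (SH j ∩ W y) = SH i ∩ SH j ∩ W y := by
            ext q
            simp only [Finset.mem_inter]
            tauto
          rw [e]
          exact hI y hy i hi' j (Finset.mem_range.1 hj)
        calc ∑ j ∈ Finset.range i, (((SH i ∩ W y) ∩ (SH j ∩ W y)).card : ℝ)
            ≤ ∑ _j ∈ Finset.range i, τ := Finset.sum_le_sum h4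
          _ = i * τ := by rw [Finset.sum_const, Finset.card_range, nsmul_eq_mul]
          _ ≤ m * τ := mul_le_mul_of_nonneg_right (by exact_mod_cast hi'.le) hτ
      calc ∑ i ∈ Finset.range m, ∑ j ∈ Finset.range i, (((SH i ∩ W y) ∩ (SH j ∩ W y)).card : ℝ)
          ≤ ∑ _i ∈ Finset.range m, (m : ℝ) * τ := Finset.sum_le_sum h3
        _ = (m : ℝ) ^ 2 * τ := by rw [Finset.sum_const, Finset.card_range, nsmul_eq_mul]; ring
    linarith
  calc ∑ i ∈ Finset.range m, ((SH i ∩ Xh).card : ℝ)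
      ≤ ∑ i ∈ Finset.range m, ∑ y ∈ Y, ((SH i ∩ W y).card : ℝ) := Finset.sum_le_sum fun i _ => h1 i
    _ = ∑ y ∈ Y, ∑ i ∈ Finset.range m, ((SH i ∩ W y).card : ℝ) := Finset.sum_comm
    _ ≤ ∑ y ∈ Y, (((W y).card : ℝ) + (m : ℝ) ^ 2 * τ) := Finset.sum_le_sum h2
    _ = ∑ y ∈ Y, ((W y).card : ℝ) + (Y.card : ℝ) * ((m : ℝ) ^ 2 * τ) := by
        rw [Finset.sum_add_distrib, Finset.sum_const, nsmul_eq_mul]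

/-- **The diffuse remainder is light.** Let `G` lie within `6L/5` of `x a` and let `Xℓ ⊆ G` consist
of particles not within `2r₁` of any heavy particle `h` (`≥ c₂ L` particles within `2r₁` of `x h`)
lying within `6L/5` of `x a`.  Then every `r₁`-ball holds fewer than `c₂ L` particles of `Xℓ`
(`c₂ L > 0`): a non-empty such set lies within `2r₁` of any of its members `j₀`, which is not heavy.
[folklore] -/
theorem sparse_light :
    ∀ {N : ℕ} (x : Fin N → E3) (a : Fin N) (G Xℓ : Finset (Fin N)) {L r₁ c₂ : ℝ},
    0 < c₂ * L → (∀ j ∈ G, dist (x j) (x a) ≤ 6 / 5 * L) →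
    (∀ j ∈ Xℓ, j ∈ G ∧ ∀ h : Fin N,
      c₂ * L ≤ ((Finset.univ.filter fun q => dist (x q) (x h) ≤ 2 * r₁).card : ℝ) →
        dist (x h) (x a) ≤ 6 / 5 * L → ¬ dist (x j) (x h) ≤ 2 * r₁) →
    ∀ z : E3, ((Xℓ.filter fun j => dist (x j) z ≤ r₁).card : ℝ) < c₂ * L := by
  intro N x a G Xℓ L r₁ c₂ hc hG hXℓ z
  rcases (Xℓ.filter fun j => dist (x j) z ≤ r₁).eq_empty_or_nonempty with hemp | ⟨j₀, hj₀⟩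
  · rw [hemp, Finset.card_empty, Nat.cast_zero]
    exact hc
  have hj₀' := Finset.mem_filter.1 hj₀
  obtain ⟨hj₀G, hj₀far⟩ := hXℓ j₀ hj₀'.1
  -- the set lies in the `2r₁`-ball of `j₀`
  have hsub : (Xℓ.filter fun j => dist (x j) z ≤ r₁) ⊆
      Finset.univ.filter fun q => dist (x q) (x j₀) ≤ 2 * r₁ := by
    intro j hj
    have hj' := (Finset.mem_filter.1 hj).2
    refine Finset.mem_filter.2 ⟨Finset.mem_univ _, ?_⟩
    calc dist (x j) (x j₀) ≤ dist (x j) z + dist z (x j₀) := dist_triangle _ _ _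
      _ ≤ r₁ + r₁ := by rw [dist_comm z]; exact add_le_add hj' hj₀'.2
      _ = 2 * r₁ := by ring
  have hle : ((Xℓ.filter fun j => dist (x j) z ≤ r₁).card : ℝ) ≤
      ((Finset.univ.filter fun q => dist (x q) (x j₀) ≤ 2 * r₁).card : ℝ) := by
    exact_mod_cast Finset.card_le_card hsub
  -- `j₀` is not heavy
  have hnot : ((Finset.univ.filter fun q => dist (x q) (x j₀) ≤ 2 * r₁).card : ℝ) < c₂ * L := by
    by_contra hge
    push Not at hge
    have hr : 0 ≤ r₁ := by
      have := hj₀'.2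
      linarith [dist_nonneg (x := x j₀) (y := z)]
    exact hj₀far j₀ hge (hG j₀ hj₀G) (by rw [dist_self]; positivity)
  linarith

end Summit.AtomisticToContinuum.Crystallization.Theorems.LjLaminarWindowsSketch

end
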